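import Literature.Analysis.Complex.JensenPolynomialCircleKernel
import HarnessLib

/-!
# The exact circle kernel of `J^{d,0}_γ(z/d)`, II: second-order exactness, the LOCAL error functional,
# the Gaussian-lens bounds, and the isolation-free detection criterion (winding Rouché) (all proved)

Trunk T-CA, namespace `Literature.Analysis.Complex.JensenCircleKernel` (continued). Since
`u_d(0) = u_d(1) = 1`, the Jensen error `J^{d,0}_γ(z/d) − F(z)` is EXACTLY the kernel average of
the second-order Taylor remainder `T_z(τ) = F(ze^{iτ}) − F(z) − z(e^{iτ} − 1)F′(z)` along the circle
(`jensenPoly_scaled_sub_eq_integral`); hence the LOCAL bound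
`‖J^{d,0}_γ(z/d) − F(z)‖ ≤ localErr F d z := ∫ ‖T_z(τ)‖·‖K_d(τ)‖dτ` (`norm_jensenPoly_scaled_sub_le_local`)
and its quantitative LENS forms `localErr_le_lens` (★: `|T_z| ≤ M(|z||τ|)²` on `|τ| ≤ τ₀`, `≤ B`
beyond, Gaussian kernel tail) and `localErr_le_lens_expTail` (★★: exponential-in-angle growth).
With Rouché in WINDING form — `exists_zero_of_norm_sub_lt`, via the tree's
`ArgPrinciple.wind_circleLoop_pos_of_zero_of_center`; no simplicity and no isolation hypothesis —
this gives the LOCAL DETECTION CRITERION `not_splits_jensenPoly_of_local_criterion`: a disc in the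
open upper (or lower) half-plane containing a zero of `F` on whose boundary `localErr < |F|` makes
`J^{d,0}_γ` non-hyperbolic. It weakens the hypotheses of round 2's
`JensenDetection.not_splits_jensenPoly_of_offLine_zero` (isolated SIMPLE zero, global majorant) to
«some zero inside, local error on the boundary». Rows `n ≥ 1` (zeros of `F⁽ⁿ⁾`):
`JensenPolynomialCircleKernelRows.lean`.

## Contents (all proved; definitions `taylorRem`, `localErr`)
* `taylorRem`, `jensenPoly_scaled_sub_eq_integral`, `norm_taylorRem_le`.
* `localErr`, `norm_jensenPoly_scaled_sub_le_local`, `localErr_le_lens`, `localErr_le_lens_expTail`.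
* `exists_zero_of_norm_sub_lt` (winding Rouché), `not_splits_jensenPoly_of_local_criterion`.

Provenance: cell rh-jensen (D-0074 GROUP I, negation lens round 3, `NegationLensR3Sketch.lean`
§§1–5c, planner-rh-jensen-idea-2-g3-0, 2026-08-26; farm rc 0, sorry-free), landed by
prover-rh-jensen-eng-2-g2-0 (WANTED W1 of that seat). AI-produced formalisation; AI review is weaker
than expert review. RH-free: everything is analysis of an arbitrary real sequence `γ` / entire `F`;
nothing here concerns `ξ` or bears on the truth of RH.

## References
* [CampbellJalowy2026] A. Campbell, J. Jalowy, *Pólya–Schur problems and free probability*,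
  arXiv:2605.31356 (2026), p. 9: the contour (saddle-point) representation of the Appell polynomials
  `A_{n,f}(z) = (n!/2πi)∮_Γ f(x)e^{xz}x^{-n-1}dx` (classical); read on the circle `|x| = |z|` after
  `w ↦ w/d` it is the kernel representation below.
* [CravenCsordas1989] T. Craven, G. Csordas, Pacific J. Math. 136 (1989) 241–260, Lemma 2.2 (the
  qualitative `J^{d,0}_γ(z/d) → F(z)`; its proof's multipliers `u_d(k) = d!/((d−k)! dᵏ)`).
* [Conway1978] J. B. Conway, *Functions of One Complex Variable I*, Ch. IV §2 (Taylor), Ch. V §3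
  (Rouché / argument principle; tree: `Literature.Analysis.Complex.ArgumentPrincipleWinding`).
* [GORZPNAS2019] M. Griffin, K. Ono, L. Rolen, D. Zagier, PNAS 116 (2019) 11103–11110, §1 (`J^{d,n}_γ`).
-/

noncomputable section

open Polynomial Complex Filter Topology Metric Set MeasureTheory intervalIntegral
open scoped ComplexConjugate Nat Real

namespace Literature.Analysis.Complex.JensenCircleKernel

open Literature.NumberTheory.LFunctions Literature.Analysis.Complex.PolyaSchur
  Literature.Analysis.Complex Literature.Topology.PlaneTopology

/-! ## §5 Second-order exactness and the LOCAL error functional -/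

/-- The second-order Taylor remainder of `F` along the circle through `z`:
`T_z(τ) = F(z e^{iτ}) − F(z) − z(e^{iτ} − 1) F'(z)`. [folklore] -/
def taylorRem (F : ℂ → ℂ) (z : ℂ) (τ : ℝ) : ℂ :=
  F (z * exp (τ * I)) - F z - z * (exp (τ * I) - 1) * deriv F z
/-- The second-order Taylor remainder along the circle is continuous in the angle. [folklore] -/
private theorem continuous_taylorRem {F : ℂ → ℂ} (hFc : Continuous F) (z : ℂ) :
    Continuous (taylorRem F z) := by
  unfold taylorRem; fun_prop

/-- **Second-order exactness.** `J^{d,0}_γ(z/d) − F(z) = ∫_{-π}^{π} T_z(τ) K_d(τ) dτ`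
(because `∫ K_d = ∫ e^{iτ} K_d = 1`): the Jensen error only sees the second-order Taylor
remainder of `F` on the circle `|ζ| = |z|`, weighted by a kernel of angular width `≍ 1/√d`.
[cite: CravenCsordas1989, Lemma 2.2 (exact form of the error)] [cite: CampbellJalowy2026, p. 9] -/
theorem jensenPoly_scaled_sub_eq_integral {γ : ℕ → ℝ} {F : ℂ → ℂ}
    (hF : ∀ w : ℂ, HasSum (fun j => (γ j : ℂ) / (j ! : ℂ) * w ^ j) (F w))
    (hsum : ∀ R : ℝ, 0 ≤ R → Summable fun j => |γ j| / (j ! : ℝ) * R ^ j)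
    (hFc : Continuous F) {d : ℕ} (hd : 0 < d) (z : ℂ) :
    aeval (z / d) (jensenPoly γ d 0) - F z = ∫ τ in (-π)..π, taylorRem F z τ * jensenKernel d τ := by
  have hK := continuous_jensenKernel d
  have hA : IntervalIntegrable (fun τ : ℝ => F (z * exp (τ * I)) * jensenKernel d τ) volume (-π) π :=
    Continuous.intervalIntegrable (by fun_prop) _ _
  have hB : IntervalIntegrable (fun τ : ℝ => F z * jensenKernel d τ) volume (-π) π :=
    Continuous.intervalIntegrable (by fun_prop) _ _
  have hC : IntervalIntegrable
      (fun τ : ℝ => z * (exp (τ * I) - 1) * deriv F z * jensenKernel d τ) volume (-π) π :=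
    Continuous.intervalIntegrable (by fun_prop) _ _
  have hsplit : (fun τ : ℝ => taylorRem F z τ * jensenKernel d τ) = fun τ : ℝ =>
      (F (z * exp (τ * I)) * jensenKernel d τ - F z * jensenKernel d τ)
        - z * (exp (τ * I) - 1) * deriv F z * jensenKernel d τ := by
    funext τ; simp only [taylorRem]; ring
  rw [hsplit, intervalIntegral.integral_sub (hA.sub hB) hC, intervalIntegral.integral_sub hA hB,
    integral_mul_jensenKernel_eq hF hsum hd z, intervalIntegral.integral_const_mul,
    integral_jensenKernel hd]
  have hC' : ∫ τ in (-π)..π, z * (exp (τ * I) - 1) * deriv F z * jensenKernel d τ = 0 := by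
    have : (fun τ : ℝ => z * (exp (τ * I) - 1) * deriv F z * jensenKernel d τ) = fun τ : ℝ =>
        z * deriv F z * (exp (τ * I) * jensenKernel d τ) - z * deriv F z * jensenKernel d τ := by
      funext τ; ring
    rw [this, intervalIntegral.integral_sub (Continuous.intervalIntegrable (by fun_prop) _ _)
      (Continuous.intervalIntegrable (by fun_prop) _ _), intervalIntegral.integral_const_mul,
      intervalIntegral.integral_const_mul, integral_cexp_mul_jensenKernel hd,
      integral_jensenKernel hd, sub_self]
  rw [hC']; ring

/-- **Second-order Taylor remainder along a chord**: if `‖F''‖ ≤ M` on the segment `[z, ζ]`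
then `‖F(ζ) − F(z) − (ζ − z)F'(z)‖ ≤ M‖ζ − z‖²` (two applications of the mean-value inequality
`Convex.norm_image_sub_le_of_norm_deriv_le`). [folklore] -/
private theorem norm_taylor2_le {F : ℂ → ℂ} (hF : Differentiable ℂ F) {z ζ : ℂ} {M : ℝ}
    (hM : ∀ w ∈ segment ℝ z ζ, ‖deriv (deriv F) w‖ ≤ M) :
    ‖F ζ - F z - (ζ - z) * deriv F z‖ ≤ M * ‖ζ - z‖ ^ 2 := by
  have hconv : Convex ℝ (segment ℝ z ζ) := convex_segment z ζ
  have hz : z ∈ segment ℝ z ζ := left_mem_segment ℝ z ζ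
  have hζ : ζ ∈ segment ℝ z ζ := right_mem_segment ℝ z ζ
  have hFa : AnalyticOnNhd ℂ F univ := fun x _ => hF.analyticAt x
  have hF' : Differentiable ℂ (deriv F) := fun w => (hFa.deriv w trivial).differentiableAt
  have hM0 : 0 ≤ M := (norm_nonneg _).trans (hM z hz)
  have h1 : ∀ w ∈ segment ℝ z ζ, ‖deriv F w - deriv F z‖ ≤ M * ‖ζ - z‖ := by
    intro w hw
    have hsub : segment ℝ z w ⊆ segment ℝ z ζ := hconv.segment_subset hz hw
    have h := Convex.norm_image_sub_le_of_norm_deriv_le (f := deriv F) (fun x _ => hF' x)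
      (fun x hx => hM x (hsub hx)) (convex_segment z w) (left_mem_segment ℝ z w)
      (right_mem_segment ℝ z w)
    refine h.trans (mul_le_mul_of_nonneg_left ?_ hM0)
    rw [segment_eq_image'] at hw
    obtain ⟨θ, ⟨h0, h1⟩, rfl⟩ := hw
    rw [add_sub_cancel_left, norm_smul, Real.norm_eq_abs, abs_of_nonneg h0]
    exact mul_le_of_le_one_left (norm_nonneg _) h1
  set G : ℂ → ℂ := fun w => F w - F z - (w - z) * deriv F z with hG
  have hGd : ∀ w, DifferentiableAt ℂ G w := fun w => by simp only [hG]; fun_prop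
  have hGd' : ∀ w, deriv G w = deriv F w - deriv F z := fun w => by
    simp only [hG]
    rw [deriv_fun_sub (by fun_prop) (by fun_prop), deriv_sub_const, deriv_mul_const (by fun_prop),
      deriv_sub_const, deriv_id'', one_mul]
  have h2 := Convex.norm_image_sub_le_of_norm_deriv_le (f := G)
    (fun w _ => hGd w) (fun w hw => by rw [hGd' w]; exact h1 w hw) hconv hz hζ
  have hG0 : G z = 0 := by simp [hG]
  rw [hG0, sub_zero] at h2
  calc ‖F ζ - F z - (ζ - z) * deriv F z‖ = ‖G ζ‖ := rfl
    _ ≤ M * ‖ζ - z‖ * ‖ζ - z‖ := h2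
    _ = M * ‖ζ - z‖ ^ 2 := by ring

/-- `|T_z(τ)| ≤ sup_{[z, z e^{iτ}]}|F''| · (|z| |τ|)²` — the remainder is quadratic in the
angle, which is what makes the Gaussian kernel average LOCAL and of size `≍ |z|² |F''|/d`.
[cite: Conway1978, Ch. IV §2 (Taylor's formula with remainder)] -/
theorem norm_taylorRem_le {F : ℂ → ℂ} (hF : Differentiable ℂ F) (z : ℂ) (τ : ℝ) {M : ℝ}
    (hM : ∀ w ∈ segment ℝ z (z * exp (τ * I)), ‖deriv (deriv F) w‖ ≤ M) :
    ‖taylorRem F z τ‖ ≤ M * (‖z‖ * |τ|) ^ 2 := by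
  have h := norm_taylor2_le hF hM
  have hM0 : 0 ≤ M := (norm_nonneg _).trans (hM z (left_mem_segment ℝ _ _))
  have hchord : ‖z * exp (τ * I) - z‖ ≤ ‖z‖ * |τ| := by
    have : z * exp (τ * I) - z = z * (exp (I * τ) - 1) := by rw [mul_comm (τ : ℂ) I]; ring
    rw [this, norm_mul]
    refine mul_le_mul_of_nonneg_left ?_ (norm_nonneg z)
    have h1 := Real.norm_exp_I_mul_ofReal_sub_one_le (x := τ)
    rwa [Real.norm_eq_abs] at h1
  have hT : taylorRem F z τ = F (z * exp (τ * I)) - F z - (z * exp (τ * I) - z) * deriv F z := by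
    simp only [taylorRem]; ring
  rw [hT]
  exact h.trans (mul_le_mul_of_nonneg_left (pow_le_pow_left₀ (norm_nonneg _) hchord 2) hM0)

/-- The LOCAL Jensen error functional at `z` in degree `d`:
`L_d(F, z) = K_d(0) · ∫_{-π}^{π} |T_z(τ)| e^{−2dτ²/π²} dτ`. [folklore] -/
def localErr (F : ℂ → ℂ) (d : ℕ) (z : ℂ) : ℝ :=
  jensenKernelPeak d * ∫ τ in (-π)..π, ‖taylorRem F z τ‖ * Real.exp (-(2 * d / π ^ 2) * τ ^ 2)

/-- **Local error bound.** `|J^{d,0}_γ(z/d) − F(z)| ≤ L_d(F, z)`. With `|T_z(τ)| ≤ |z|²τ²·sup|F''|`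
on the short arc this is `≲ |z|² sup_{arc}|F''| / d` — the global majorant `E_γ(R)/(2d)` of round 2
replaced by a LOCAL quantity (memo §1, eq. (★)).
[cite: CravenCsordas1989, Lemma 2.2 (local effective form)] -/
theorem norm_jensenPoly_scaled_sub_le_local {γ : ℕ → ℝ} {F : ℂ → ℂ}
    (hF : ∀ w : ℂ, HasSum (fun j => (γ j : ℂ) / (j ! : ℂ) * w ^ j) (F w))
    (hsum : ∀ R : ℝ, 0 ≤ R → Summable fun j => |γ j| / (j ! : ℝ) * R ^ j)
    (hFc : Continuous F) {d : ℕ} (hd : 0 < d) (z : ℂ) :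
    ‖aeval (z / d) (jensenPoly γ d 0) - F z‖ ≤ localErr F d z := by
  rw [jensenPoly_scaled_sub_eq_integral hF hsum hFc hd z, localErr,
    ← intervalIntegral.integral_const_mul]
  refine intervalIntegral.norm_integral_le_of_norm_le (by linarith [Real.pi_pos])
    (ae_of_all _ fun τ hτ => ?_) (Continuous.intervalIntegrable (by
      have := continuous_taylorRem hFc z; fun_prop) _ _)
  have hτ' : |τ| ≤ π := abs_le.2 ⟨hτ.1.le, hτ.2⟩
  rw [norm_mul]
  calc ‖taylorRem F z τ‖ * ‖jensenKernel d τ‖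
      ≤ ‖taylorRem F z τ‖ * (jensenKernelPeak d * Real.exp (-(2 * d / π ^ 2) * τ ^ 2)) :=
        mul_le_mul_of_nonneg_left (norm_jensenKernel_le d hτ') (norm_nonneg _)
    _ = jensenKernelPeak d * (‖taylorRem F z τ‖ * Real.exp (-(2 * d / π ^ 2) * τ ^ 2)) := by ring

/-! ## §5b Rouché in winding form: zero existence WITHOUT simplicity or isolation -/

/-- The peak value of the kernel is nonnegative. [folklore] -/
private theorem jensenKernelPeak_nonneg (d : ℕ) : 0 ≤ jensenKernelPeak d := by
  unfold jensenKernelPeak; positivity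

/-- **(★) The lens bound.** If `|F''| ≤ M` on every chord `[z, z e^{iτ}]` with `|τ| ≤ τ₀`
(the LENS around `z`) and `|T_z(τ)| ≤ B` for all `|τ| ≤ π` (a crude global size bound), then
`localErr_d(F, z) ≤ peak_d · ( M |z|² ∫_{-π}^{π} τ² e^{-2dτ²/π²} dτ + 2π B e^{-2dτ₀²/π²} )`:
a LOCAL main term `≍ |z|² sup_lens|F''| / d` (since `peak_d ≤ e√d/2π` and the Gaussian second
moment is `≤ (π/2)^{5/2} Γ(3/2)… ≍ d^{-3/2}`) plus a tail killed by the Gaussian factor as soon as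
`d ≫ log B / τ₀²`.  This is the quantitative form behind the detection theorems of the memo.
[cite: CampbellJalowy2026, p. 9 (saddle-point localisation)] [cite: CravenCsordas1989, Lemma 2.2] -/
theorem localErr_le_lens {F : ℂ → ℂ} (hF : Differentiable ℂ F) (z : ℂ) (d : ℕ) {τ₀ M B : ℝ}
    (hτ₀ : 0 ≤ τ₀)
    (hM : ∀ τ : ℝ, |τ| ≤ τ₀ → ∀ w ∈ segment ℝ z (z * exp (τ * I)), ‖deriv (deriv F) w‖ ≤ M)
    (hB : ∀ τ : ℝ, |τ| ≤ π → ‖taylorRem F z τ‖ ≤ B) :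
    localErr F d z ≤ jensenKernelPeak d *
      (M * ‖z‖ ^ 2 * (∫ τ in (-π)..π, τ ^ 2 * Real.exp (-(2 * d / π ^ 2) * τ ^ 2))
        + 2 * π * B * Real.exp (-(2 * d / π ^ 2) * τ₀ ^ 2)) := by
  unfold localErr
  refine mul_le_mul_of_nonneg_left ?_ (jensenKernelPeak_nonneg d)
  set g : ℝ → ℝ := fun τ => Real.exp (-(2 * d / π ^ 2) * τ ^ 2) with hg
  have hM0 : 0 ≤ M :=
    (norm_nonneg _).trans (hM 0 (by simpa using hτ₀) z (left_mem_segment ℝ _ _))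
  have hpt : ∀ τ ∈ Set.Icc (-π) π, ‖taylorRem F z τ‖ * g τ ≤
      M * ‖z‖ ^ 2 * (τ ^ 2 * g τ) + B * g τ₀ := by
    intro τ hτ
    have hτπ : |τ| ≤ π := abs_le.2 ⟨hτ.1, hτ.2⟩
    have hB0 : 0 ≤ B := (norm_nonneg _).trans (hB τ hτπ)
    have hg0 : 0 ≤ g τ := (Real.exp_pos _).le
    rcases le_or_gt |τ| τ₀ with hle | hlt
    · have h1 := norm_taylorRem_le hF z τ (hM τ hle)
      calc ‖taylorRem F z τ‖ * g τ ≤ M * (‖z‖ * |τ|) ^ 2 * g τ :=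
            mul_le_mul_of_nonneg_right h1 hg0
        _ = M * ‖z‖ ^ 2 * (τ ^ 2 * g τ) := by rw [mul_pow, sq_abs]; ring
        _ ≤ _ := le_add_of_nonneg_right (mul_nonneg hB0 (Real.exp_pos _).le)
    · have hgg : g τ ≤ g τ₀ := by
        simp only [hg]
        apply Real.exp_le_exp.2
        have hc : 0 ≤ 2 * (d : ℝ) / π ^ 2 := by positivity
        have hsq : τ₀ ^ 2 ≤ τ ^ 2 := by
          rw [← sq_abs τ]; exact pow_le_pow_left₀ hτ₀ hlt.le 2
        nlinarith
      have hM0' : 0 ≤ M * ‖z‖ ^ 2 * (τ ^ 2 * g τ) := by positivity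
      calc ‖taylorRem F z τ‖ * g τ ≤ B * g τ₀ := mul_le_mul (hB τ hτπ) hgg hg0 hB0
        _ ≤ _ := le_add_of_nonneg_left hM0'
  have hcT : Continuous fun τ : ℝ => ‖taylorRem F z τ‖ * g τ :=
    (continuous_taylorRem hF.continuous z).norm.mul (by simp only [hg]; fun_prop)
  have hc1 : Continuous fun τ : ℝ => M * ‖z‖ ^ 2 * (τ ^ 2 * g τ) := by simp only [hg]; fun_prop
  have hc2 : Continuous fun _ : ℝ => B * g τ₀ := continuous_const
  have hππ : -π ≤ π := by linarith [Real.pi_pos]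
  calc ∫ τ in (-π)..π, ‖taylorRem F z τ‖ * g τ
      ≤ ∫ τ in (-π)..π, (M * ‖z‖ ^ 2 * (τ ^ 2 * g τ) + B * g τ₀) :=
        intervalIntegral.integral_mono_on hππ (hcT.intervalIntegrable _ _)
          ((hc1.add hc2).intervalIntegrable _ _) hpt
    _ = M * ‖z‖ ^ 2 * (∫ τ in (-π)..π, τ ^ 2 * g τ) + 2 * π * B * g τ₀ := by
        rw [intervalIntegral.integral_add (hc1.intervalIntegrable _ _) (hc2.intervalIntegrable _ _),
          intervalIntegral.integral_const_mul, intervalIntegral.integral_const, smul_eq_mul]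
        ring

/-- **(★★) The lens bound with a Gaussian-beaten exponential tail.** As `localErr_le_lens`, but
the crude size bound is replaced by a growth bound that is LINEAR IN THE ANGLE in the exponent,
`|T_z(τ)| ≤ exp(Λ + B₁|τ|)` on `|τ| ≤ π` (for `ξ`: `B₁ ≍ γ₀ log γ₀`, `Λ = O(log γ₀ · log(1/δ))`
after local normalisation): once `B₁ ≤ (d/π²)·τ₀` the Gaussian wins on `|τ| ≥ τ₀` and the tail is
`≤ 2π·exp(Λ − dτ₀²/π²)` — this is what keeps THEOREM A's tail condition polynomial
(`d ≳ π²B₁/τ₀` and `d ≳ π²Λ/τ₀²`) instead of `d ≳ (global log-sup)/τ₀²`.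
[cite: CampbellJalowy2026, p. 9 (saddle-point localisation)] [cite: CravenCsordas1989, Lemma 2.2] -/
theorem localErr_le_lens_expTail {F : ℂ → ℂ} (hF : Differentiable ℂ F) (z : ℂ) (d : ℕ)
    {τ₀ M Λ B₁ : ℝ} (hτ₀ : 0 ≤ τ₀)
    (hM : ∀ τ : ℝ, |τ| ≤ τ₀ → ∀ w ∈ segment ℝ z (z * exp (τ * I)), ‖deriv (deriv F) w‖ ≤ M)
    (hB : ∀ τ : ℝ, |τ| ≤ π → ‖taylorRem F z τ‖ ≤ Real.exp (Λ + B₁ * |τ|))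
    (hd : B₁ ≤ (d : ℝ) / π ^ 2 * τ₀) :
    localErr F d z ≤ jensenKernelPeak d *
      (M * ‖z‖ ^ 2 * (∫ τ in (-π)..π, τ ^ 2 * Real.exp (-(2 * d / π ^ 2) * τ ^ 2))
        + 2 * π * Real.exp (Λ - (d : ℝ) / π ^ 2 * τ₀ ^ 2)) := by
  unfold localErr
  refine mul_le_mul_of_nonneg_left ?_ (jensenKernelPeak_nonneg d)
  set g : ℝ → ℝ := fun τ => Real.exp (-(2 * d / π ^ 2) * τ ^ 2) with hg
  set E : ℝ := Real.exp (Λ - (d : ℝ) / π ^ 2 * τ₀ ^ 2) with hE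
  have hE0 : 0 ≤ E := (Real.exp_pos _).le
  have hM0 : 0 ≤ M :=
    (norm_nonneg _).trans (hM 0 (by simpa using hτ₀) z (left_mem_segment ℝ _ _))
  have hpt : ∀ τ ∈ Set.Icc (-π) π, ‖taylorRem F z τ‖ * g τ ≤
      M * ‖z‖ ^ 2 * (τ ^ 2 * g τ) + E := by
    intro τ hτ
    have hτπ : |τ| ≤ π := abs_le.2 ⟨hτ.1, hτ.2⟩
    have hg0 : 0 ≤ g τ := (Real.exp_pos _).le
    rcases le_or_gt |τ| τ₀ with hle | hlt
    · have h1 := norm_taylorRem_le hF z τ (hM τ hle)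
      calc ‖taylorRem F z τ‖ * g τ ≤ M * (‖z‖ * |τ|) ^ 2 * g τ :=
            mul_le_mul_of_nonneg_right h1 hg0
        _ = M * ‖z‖ ^ 2 * (τ ^ 2 * g τ) := by rw [mul_pow, sq_abs]; ring
        _ ≤ _ := le_add_of_nonneg_right hE0
    · have hc0 : 0 ≤ (d : ℝ) / π ^ 2 := by positivity
      have hsq : τ₀ ^ 2 ≤ τ ^ 2 := by
        rw [← sq_abs τ]; exact pow_le_pow_left₀ hτ₀ hlt.le 2
      have hA : B₁ * |τ| ≤ (d : ℝ) / π ^ 2 * τ ^ 2 :=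
        calc B₁ * |τ| ≤ (d : ℝ) / π ^ 2 * τ₀ * |τ| := mul_le_mul_of_nonneg_right hd (abs_nonneg τ)
          _ ≤ (d : ℝ) / π ^ 2 * |τ| * |τ| := by gcongr
          _ = (d : ℝ) / π ^ 2 * τ ^ 2 := by rw [mul_assoc, ← pow_two, sq_abs]
      have hBd : (d : ℝ) / π ^ 2 * τ₀ ^ 2 ≤ (d : ℝ) / π ^ 2 * τ ^ 2 :=
        mul_le_mul_of_nonneg_left hsq hc0
      have h2 : ‖taylorRem F z τ‖ * g τ ≤ E := by
        calc ‖taylorRem F z τ‖ * g τ ≤ Real.exp (Λ + B₁ * |τ|) * g τ :=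
              mul_le_mul_of_nonneg_right (hB τ hτπ) hg0
          _ = Real.exp (Λ + B₁ * |τ| + -(2 * d / π ^ 2) * τ ^ 2) := by
              simp only [hg]; rw [← Real.exp_add]
          _ ≤ E := by
              simp only [hE]
              apply Real.exp_le_exp.2
              have : (2 * (d : ℝ) / π ^ 2) * τ ^ 2 = 2 * ((d : ℝ) / π ^ 2 * τ ^ 2) := by ring
              linarith
      have hM0' : 0 ≤ M * ‖z‖ ^ 2 * (τ ^ 2 * g τ) := by positivity
      exact h2.trans (le_add_of_nonneg_left hM0')
  have hcT : Continuous fun τ : ℝ => ‖taylorRem F z τ‖ * g τ :=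
    (continuous_taylorRem hF.continuous z).norm.mul (by simp only [hg]; fun_prop)
  have hc1 : Continuous fun τ : ℝ => M * ‖z‖ ^ 2 * (τ ^ 2 * g τ) := by simp only [hg]; fun_prop
  have hc2 : Continuous fun _ : ℝ => E := continuous_const
  have hππ : -π ≤ π := by linarith [Real.pi_pos]
  calc ∫ τ in (-π)..π, ‖taylorRem F z τ‖ * g τ
      ≤ ∫ τ in (-π)..π, (M * ‖z‖ ^ 2 * (τ ^ 2 * g τ) + E) :=
        intervalIntegral.integral_mono_on hππ (hcT.intervalIntegrable _ _)
          ((hc1.add hc2).intervalIntegrable _ _) hpt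
    _ = M * ‖z‖ ^ 2 * (∫ τ in (-π)..π, τ ^ 2 * g τ) + 2 * π * E := by
        rw [intervalIntegral.integral_add (hc1.intervalIntegrable _ _) (hc2.intervalIntegrable _ _),
          intervalIntegral.integral_const_mul, intervalIntegral.integral_const, smul_eq_mul]
        ring

/-- If `f, g` are holomorphic on `‖z - c‖ < ρ`, `‖f − g‖ < ‖g‖` on the circle `‖z − c‖ = r`
(`0 < r < ρ`) and `g` has SOME zero inside the circle, then `f` has a zero inside the circle
(tree: winding-number Rouché `Rouche.wind_circleLoop_eq_of_norm_sub_lt`, positivity of the winding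
number at a zero `wind_circleLoop_pos_of_zero_of_center`, and the argument principle
`Rouche.wind_circleLoop_eq_finsum_divisor` to read a zero off a non-zero winding number).
[folklore] -/
private theorem ne_zero_of_norm_sub_lt {a b : ℂ} (h : ‖a - b‖ < ‖b‖) : a ≠ 0 ∧ b ≠ 0 := by
  constructor
  · rintro rfl
    rw [zero_sub, norm_neg] at h
    exact lt_irrefl _ h
  · rintro rfl
    rw [norm_zero] at h
    exact absurd h (not_lt.2 (norm_nonneg _))
/-- **Rouché in winding form (zero existence; no simplicity, no isolation).** If `f`, `g` are
holomorphic on `B(c, ρ)`, `0 < r < ρ`, `g` has a zero in the open ball `B(c, r)` and `‖f − g‖ < ‖g‖` on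
the circle `‖z − c‖ = r`, then `f` has a zero in `B(c, r)`: both winding numbers along the circle are
defined (neither function vanishes there), they agree by the straight-line homotopy, the one of `g`
is positive by the argument principle (`ArgPrinciple.wind_circleLoop_pos_of_zero_of_center`), and a
positive winding number of `f ∘ γ` forces a zero of `f` inside. [cite: Conway1978, Ch. V §3 (Rouché's theorem)] -/
theorem exists_zero_of_norm_sub_lt {f g : ℂ → ℂ} {c : ℂ} {ρ r : ℝ} (hr : 0 < r) (hrρ : r < ρ)
    (hf : DifferentiableOn ℂ f (ball c ρ)) (hg : DifferentiableOn ℂ g (ball c ρ))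
    (h : ∀ z : ℂ, ‖z - c‖ = r → ‖f z - g z‖ < ‖g z‖) {η₀ : ℂ} (hη₀ : ‖η₀ - c‖ < r)
    (hg0 : g η₀ = 0) : ∃ u : ℂ, ‖u - c‖ < r ∧ f u = 0 := by
  have hgs : ∀ z : ℂ, ‖z - c‖ = r → g z ≠ 0 := fun z hz => (ne_zero_of_norm_sub_lt (h z hz)).2
  have hfs : ∀ z : ℂ, ‖z - c‖ = r → f z ≠ 0 := fun z hz => (ne_zero_of_norm_sub_lt (h z hz)).1
  have hpos := wind_circleLoop_pos_of_zero_of_center g hr hrρ hg hη₀ hg0 hgs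
  rw [← Rouche.wind_circleLoop_eq_of_norm_sub_lt hr hrρ hf hg h,
    Rouche.wind_circleLoop_eq_finsum_divisor f hr hrρ hf hfs] at hpos
  by_contra hne
  push Not at hne
  have hzero : (fun u => MeromorphicOn.divisor f (closedBall c r) u) = fun _ => 0 := by
    funext u
    by_contra hu
    obtain ⟨hu1, hu2⟩ := (Rouche.divisor_ne_zero_iff f hr hrρ hf hfs u).1 hu
    have hlt : ‖u - c‖ < r := by
      rw [mem_closedBall, dist_eq_norm] at hu1
      exact lt_of_le_of_ne hu1 fun heq => hfs u heq hu2
    exact hne u hlt hu2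
  rw [hzero, finsum_zero] at hpos
  exact lt_irrefl _ hpos

/-- **LOCAL DETECTION CRITERION (RH-free).** Let `F(w) = Σ γⱼ wʲ/j!` be entire with real Taylor
data, `B = {‖w − c‖ ≤ r}` a disc in the OPEN upper (or lower) half-plane (`r < |Im c|`) containing
a zero of `F` in its interior — any multiplicity, any other zeros allowed — and suppose the local
error functional is dominated on the circle: `L_d(F, w) < |F(w)|` for `‖w − c‖ = r`. Then
`J^{d,0}_γ` is not hyperbolic.
[cite: Conway1978, Ch. V §3 (Rouché)] [cite: CravenCsordas1989, Lemma 2.2] -/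
theorem not_splits_jensenPoly_of_local_criterion {γ : ℕ → ℝ} {F : ℂ → ℂ}
    (hF : ∀ w : ℂ, HasSum (fun j => (γ j : ℂ) / (j ! : ℂ) * w ^ j) (F w))
    (hsum : ∀ R : ℝ, 0 ≤ R → Summable fun j => |γ j| / (j ! : ℝ) * R ^ j)
    (hFd : Differentiable ℂ F) {c η₀ : ℂ} {r : ℝ} (hr : 0 < r) (hrim : r < |c.im|)
    (hη₀ : ‖η₀ - c‖ < r) (hFη₀ : F η₀ = 0) {d : ℕ} (hd : 0 < d)
    (hloc : ∀ w : ℂ, ‖w - c‖ = r → localErr F d w < ‖F w‖) :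
    ¬ (jensenPoly γ d 0).Splits := by
  intro hs
  set f : ℂ → ℂ := fun w => aeval (w / d) (jensenPoly γ d 0) with hf
  have hfd : DifferentiableOn ℂ f (ball c (r + 1)) :=
    ((Polynomial.differentiable_aeval (jensenPoly γ d 0)).comp
      (differentiable_id.div_const (d : ℂ))).differentiableOn
  have hrou : ∀ w : ℂ, ‖w - c‖ = r → ‖f w - F w‖ < ‖F w‖ := fun w hw =>
    (norm_jensenPoly_scaled_sub_le_local hF hsum hFd.continuous hd w).trans_lt (hloc w hw)
  obtain ⟨u, hu, hfu⟩ := exists_zero_of_norm_sub_lt hr (by linarith) hfd hFd.differentiableOn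
    hrou hη₀ hFη₀
  have hJ0 : jensenPoly γ d 0 ≠ 0 := by
    intro h0
    have h1 := hrou (c + r) (by simp [abs_of_pos hr])
    simp [hf, h0] at h1
  have him : (u / (d : ℂ)).im = 0 := im_eq_zero_of_splits_of_aeval_eq_zero hs hJ0 hfu
  have huim : u.im = 0 := by
    rw [Complex.div_natCast_im] at him
    have hd' : (d : ℝ) ≠ 0 := by exact_mod_cast hd.ne'
    rcases div_eq_zero_iff.1 him with h | h
    · exact h
    · exact absurd h hd'
  have h1 : |(u - c).im| ≤ ‖u - c‖ := Complex.abs_im_le_norm _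
  rw [Complex.sub_im, huim, zero_sub, abs_neg] at h1
  linarith

end Literature.Analysis.Complex.JensenCircleKernel
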